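import Mathlib.MeasureTheory.Function.LpSpace.Complete
import Mathlib.Topology.Order.LiminfLimsup
import Literature.Barriers.AnomalousDissipation.IntermittentDissipationSteps
import Literature.Analysis.FluidPDE.ClassicalNSModeCompactness
import Literature.Analysis.FunctionSpaces.TorusSpaceTimeL3Cauchy
import Literature.Analysis.FunctionSpaces.BesovDifferenceProofs
import Literature.Analysis.FunctionSpaces.BesovLowerSemicontinuity
import HarnessLib

/-!
# Discharge of the Aubin–Lions–Simon step of De Rosa–Isett's Thm. 2.13
# (`DeRosaIsett2024_s61_compactness_holds`)

`Literature.Barriers.AnomalousDissipation.IntermittentDissipationSteps` vendors as the named fact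
`DeRosaIsett2024_s61_compactness` the compactness step of De Rosa–Isett's proof of the
vanishing-viscosity intermittency theorem (ARMA 248 (2024) = arXiv:2212.08176, §6.1: "we can find
a subsequence such that `‖v^ν‖_{L^p_t(B^θ_{p,∞})} ≤ C`. In particular, since `θ > 0`, by the
Aubin-Lions-Simon Lemma we can extract a further subsequence such that `v^ν → v` in `L^p_{x,t}`";
Simon 1987, §8, Cor. 4): smooth solutions of the unforced Navier–Stokes equations on the open
strip `(0,T) × T^d` with `ν_j → 0`, uniformly bounded in `L^q(0,T; B^θ_{q,∞}(T^d))`, `q ∈ [3,∞)`,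
`θ ∈ (0,1)`, have a subsequence converging strongly in `L³((0,T) × T^d)`.

This file **proves** it (`DeRosaIsett2024_s61_compactness_holds`), by the Fourier-side
Aubin–Lions–Simon argument (Robinson–Rodrigo–Sadowski 2016, Thm. 4.4, Step 3; Simon 1987, §8,
Thm. 5) assembled from the tree:

1. the `L^q_t B^θ_{q,∞}` bound gives `∫₀ᵀ ‖u_j(t)‖³_{B^θ_{3,∞}} ≤ M^q + T` (`b³ ≤ b^q + 1`, the
   torus being a probability space; `lintegral_eBesovSupNorm_three_pow_le`), hence
   `∫₀ᵀ∫|u_j|³ ≤ M^q + T`;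
2. `FluidPDE.exists_subseq_forall_modes_cauchy_L3` (`ClassicalNSModeCompactness`: time increments
   of the Fourier coefficients from the equation, diagonal extraction of convergent cell
   averages, `TimeIncrementsL3Cauchy`) extracts `φ` along which every Fourier mode is Cauchy in
   `L³(0,T)`;
3. `Torus.exists_forall_lintegral_sub_pow_three_le_of_modes` (`TorusSpaceTimeL3Cauchy`: Besov
   mollification error and finitely many modes) upgrades this to the Cauchy property of
   `(u_{φ n})` in `L³((0,T) × T^d)`;
4. along a fast further subsequence, Mathlib's `cauchy_complete_eLpNorm` (completeness of `L³`)
   produces the limit `v`.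

## Mathlib search

Mathlib (this pin): `MeasureTheory.Lp.cauchy_complete_eLpNorm`, `ENNReal.tsum_geometric_two`,
`Filter.Tendsto.bddAbove_range`; no Aubin–Lions–Simon theorem (the tree's `AubinLionsSlices` /
`AubinLionsExtraction` are the `L²`/`H¹` cylinder versions).

## References

* L. De Rosa, P. Isett, *Intermittency and lower dimensional dissipation in incompressible
  fluids*, Arch. Ration. Mech. Anal. 248 (2024), Paper No. 11 = arXiv:2212.08176, §6.1 (proof of
  Thm. 2.13). [DeRosaIsett2024]
* J. Simon, *Compact sets in the space `L^p(0,T;B)`*, Ann. Mat. Pura Appl. (4) 146 (1987),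
  65–96, §8, Thm. 5 and Cor. 4. [Simon1986]
* J. C. Robinson, J. L. Rodrigo, W. Sadowski, *The Three-Dimensional Navier–Stokes Equations*
  (CUP 2016), Thm. 4.4, Step 3. [RobinsonRodrigoSadowski2016]
-/

noncomputable section

open MeasureTheory TopologicalSpace Set Function Filter Metric UnitAddTorus
open _root_.Topology
open scoped ENNReal NNReal

namespace Literature.Barriers.AnomalousDissipation

open Literature.Analysis Literature.Analysis.FunctionSpaces Literature.Analysis.FunctionSpaces.Torus
  Literature.Analysis.FluidPDE

/-! ## From the `L^q_t B^θ_{q,∞}` bound to the `L³_t B^θ_{3,∞}` bound -/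

section Bounds

variable {d : Type*} [Fintype d]

/-- **The Besov norm is monotone in the integrability exponent on the torus** (a probability
space): `‖f‖_{B^θ_{p,∞}} ≤ ‖f‖_{B^θ_{q,∞}}` for `p ≤ q` and a.e.-strongly measurable `f` (termwise,
`eLpNorm_le_eLpNorm_of_exponent_le` for `f` and for its increments `f(· + h) - f`). [folklore] -/
theorem eBesovSupNorm_le_of_exponent_le {E : Type*} [NormedAddCommGroup E] {f : UnitAddTorus d → E}
    (hf : AEStronglyMeasurable f volume) {p q : ℝ≥0∞} (hpq : p ≤ q) (θ : ℝ) :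
    eBesovSupNorm θ p f volume ≤ eBesovSupNorm θ q f volume := by
  unfold eBesovSupNorm eBesovSupSeminorm eDiffQuotient
  refine add_le_add (eLpNorm_le_eLpNorm_of_exponent_le hpq hf) (iSup₂_mono fun h _ => ?_)
  gcongr
  exact eLpNorm_le_eLpNorm_of_exponent_le hpq ((aestronglyMeasurable_comp_add_right hf h).sub hf)

/-- `x³ ≤ x^r + 1` in `ℝ≥0∞` for real `r ≥ 3`. [folklore] -/
theorem pow_three_le_rpow_add_one (x : ℝ≥0∞) {r : ℝ} (hr : 3 ≤ r) : x ^ 3 ≤ x ^ r + 1 := by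
  rcases le_total x 1 with hx | hx
  · exact (pow_le_one₀ (by simp) hx).trans le_add_self
  · calc x ^ 3 = x ^ (3 : ℝ) := by norm_cast
      _ ≤ x ^ r := ENNReal.rpow_le_rpow_of_exponent_le hx hr
      _ ≤ x ^ r + 1 := le_self_add

/-- **Step 1 of the discharge: `∫₀ᵀ ‖u(t)‖³_{B^θ_{3,∞}} ≤ M^q + T`** for a field `u` jointly smooth
on `(0,T) × T^d` with `‖u‖_{L^q(0,T; B^θ_{q,∞})} ≤ M`, `3 ≤ q < ∞`, `θ ≤ 1` (smooth slices have
finite Besov norms, `Torus.IsSmooth.memBesovSup_holds`, so the `L^q_t` norm is the `q`-th root of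
`∫₀ᵀ ‖u(t)‖^q_{B^θ_{q,∞}}`, `eLpBesovSupNorm_eq_lintegral`; then `‖·‖_{B^θ_{3,∞}} ≤ ‖·‖_{B^θ_{q,∞}}`
and `b³ ≤ b^q + 1`). [folklore] -/
theorem lintegral_eBesovSupNorm_three_pow_le {T : ℝ}
    {u : ℝ → UnitAddTorus d → EuclideanSpace ℝ d} (hu : IsSmoothSpaceTimeOn (Ioo 0 T) u)
    {q : ℝ≥0∞} (hq : 3 ≤ q) (hq' : q ≠ ∞) {θ : ℝ} (hθ : θ ≤ 1) {M : ℝ≥0}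
    (hM : eLpBesovSupNorm q θ q u volume (Ioo 0 T) ≤ M) :
    ∫⁻ t in Ioo 0 T, eBesovSupNorm θ 3 (u t) volume ^ 3 ≤ (M : ℝ≥0∞) ^ q.toReal + ENNReal.ofReal T := by
  have hq0 : q ≠ 0 := (lt_of_lt_of_le (by norm_num) hq).ne'
  have hqr : 0 < q.toReal := ENNReal.toReal_pos hq0 hq'
  have hq3 : (3 : ℝ) ≤ q.toReal := by
    have h := ENNReal.toReal_mono hq' hq
    simpa using h
  set b : ℝ → ℝ≥0∞ := fun t => eBesovSupNorm θ q (u t) volume with hb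
  have hfin : ∀ t ∈ Ioo 0 T, b t < ∞ := fun t ht =>
    (IsSmooth.memBesovSup_holds (hu.isSmooth_slice ht) hθ q).eBesovSupNorm_lt_top
  have hfin' : ∀ᵐ t ∂(volume.restrict (Ioo 0 T)), eBesovSupNorm θ q (u t) volume < ∞ :=
    (ae_restrict_iff' measurableSet_Ioo).2 (ae_of_all _ hfin)
  have hI : ∫⁻ t in Ioo 0 T, b t ^ q.toReal ≤ (M : ℝ≥0∞) ^ q.toReal := by
    have h1 : ∫⁻ t in Ioo 0 T, b t ^ q.toReal = eLpBesovSupNorm q θ q u volume (Ioo 0 T) ^ q.toReal := by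
      rw [eLpBesovSupNorm_eq_lintegral hq0 hq' hfin', one_div, ENNReal.rpow_inv_rpow hqr.ne']
    rw [h1]
    exact ENNReal.rpow_le_rpow hM hqr.le
  have hpt : ∀ t ∈ Ioo 0 T, eBesovSupNorm θ 3 (u t) volume ^ 3 ≤ b t ^ q.toReal + 1 := by
    intro t ht
    have hmeas : AEStronglyMeasurable (u t) volume :=
      (hu.isSmooth_slice ht).continuous.aestronglyMeasurable
    calc eBesovSupNorm θ 3 (u t) volume ^ 3 ≤ b t ^ 3 := by
          gcongr
          exact eBesovSupNorm_le_of_exponent_le hmeas hq θ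
      _ ≤ b t ^ q.toReal + 1 := pow_three_le_rpow_add_one _ hq3
  have hvol : ∫⁻ _t in Ioo 0 T, (1 : ℝ≥0∞) = ENNReal.ofReal T := by
    rw [setLIntegral_const, Real.volume_Ioo, sub_zero, one_mul]
  calc ∫⁻ t in Ioo 0 T, eBesovSupNorm θ 3 (u t) volume ^ 3
      ≤ ∫⁻ t in Ioo 0 T, (b t ^ q.toReal + 1) := setLIntegral_mono' measurableSet_Ioo hpt
    _ = (∫⁻ t in Ioo 0 T, b t ^ q.toReal) + ∫⁻ _t in Ioo 0 T, (1 : ℝ≥0∞) :=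
        lintegral_add_right _ measurable_const
    _ ≤ (M : ℝ≥0∞) ^ q.toReal + ENNReal.ofReal T := by rw [hvol]; gcongr

end Bounds

/-! ## A fast subsequence -/

section Fast

/-- **Fast subsequences.** If for every `j` the pairs beyond `N j` are `e j`-close
(`a n m ≤ e j` for `n, m ≥ N j`), then along `ψ n = max_{i ≤ n} N i + n` (strictly increasing) one
has `a (ψ n) (ψ m) ≤ e j` whenever `j ≤ n` and `j ≤ m`. [folklore] -/
theorem exists_fast_subseq {a : ℕ → ℕ → ℝ≥0∞} {e : ℕ → ℝ≥0∞} {N : ℕ → ℕ}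
    (h : ∀ j n m, N j ≤ n → N j ≤ m → a n m ≤ e j) :
    ∃ ψ : ℕ → ℕ, StrictMono ψ ∧ ∀ j n m, j ≤ n → j ≤ m → a (ψ n) (ψ m) ≤ e j := by
  set ψ : ℕ → ℕ := fun n => (Finset.range (n + 1)).sup N + n with hψ
  have hψN : ∀ j n, j ≤ n → N j ≤ ψ n := fun j n hjn =>
    (Finset.le_sup (f := N) (Finset.mem_range.2 (Nat.lt_succ_of_le hjn))).trans (Nat.le_add_right _ _)
  refine ⟨ψ, strictMono_nat_of_lt_succ fun n => ?_, fun j n m hjn hjm =>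
    h j (ψ n) (ψ m) (hψN j n hjn) (hψN j m hjm)⟩
  have hmono : (Finset.range (n + 1)).sup N ≤ (Finset.range (n + 1 + 1)).sup N :=
    Finset.sup_mono (Finset.range_mono (Nat.le_succ _))
  simp only [hψ]
  omega

end Fast

/-! ## The discharge -/

/-- **Discharge of `DeRosaIsett2024_s61_compactness`** (the Aubin–Lions–Simon step of
De Rosa–Isett 2024, §6.1; Simon 1987, §8, Cor. 4), by the Fourier-side argument: the
`L^q_t B^θ_{q,∞}` bound yields `∫₀ᵀ‖u_j(t)‖³_{B^θ_{3,∞}} ≤ M^q + T`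
(`lintegral_eBesovSupNorm_three_pow_le`); `FluidPDE.exists_subseq_forall_modes_cauchy_L3` extracts a
subsequence with every Fourier mode Cauchy in `L³(0,T)` (time increments of the coefficients from
the Navier–Stokes equations, `|ν_j| ≤ sup_j ν_j`); `Torus.exists_forall_lintegral_sub_pow_three_le_of_modes`
makes the fields Cauchy in `L³((0,T) × T^d)`; along a fast further subsequence
(`exists_fast_subseq`, errors `≤ 2^{-3(j+1)}`) Mathlib's `cauchy_complete_eLpNorm` gives the strong
`L³` limit `v`, jointly measurable with `∫₀ᵀ∫|v|³ < ∞`. [cite: DeRosaIsett2024, §6.1 (proof of Thm. 2.13)] [cite: Simon1986, §8 Cor. 4] -/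
theorem DeRosaIsett2024_s61_compactness_holds : DeRosaIsett2024_s61_compactness := by
  intro d _ _ T hT ν hν hν₀ u p hNS q hq hq' θ hθ M hM
  -- Step 0: uniform bounds
  set B : ℝ≥0∞ := (M : ℝ≥0∞) ^ q.toReal + ENNReal.ofReal T with hBdef
  have hB : B ≠ ⊤ := ENNReal.add_ne_top.2
    ⟨ENNReal.rpow_ne_top_of_nonneg ENNReal.toReal_nonneg ENNReal.coe_ne_top, ENNReal.ofReal_ne_top⟩
  have hsm : ∀ j, IsSmoothSpaceTimeOn (Ioo 0 T) (u j) := fun j => (hNS j).smooth_velocity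
  have hwB : ∀ j, ∫⁻ t in Ioo 0 T, eBesovSupNorm θ 3 (u j t) volume ^ 3 ≤ B := fun j =>
    lintegral_eBesovSupNorm_three_pow_le (hsm j) hq hq' hθ.2.le (hM j)
  have hL3 : ∀ j, ∫⁻ t in Ioo 0 T, ∫⁻ x, ‖u j t x‖ₑ ^ 3 ≤ B := fun j =>
    (setLIntegral_mono' measurableSet_Ioo fun t _ =>
      lintegral_enorm_pow_three_le_eBesovSupNorm_pow θ (u j t)).trans (hwB j)
  -- the viscosities are bounded
  obtain ⟨νmax, hνmax⟩ := hν₀.bddAbove_range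
  have hνb : ∀ j, |ν j| ≤ νmax := fun j => by
    rw [abs_of_pos (hν j)]
    exact hνmax ⟨j, rfl⟩
  -- Step 1: a subsequence with Cauchy Fourier modes
  obtain ⟨φ, hφ, hmodes⟩ := exists_subseq_forall_modes_cauchy_L3 hT hνb hNS hB hL3
  -- Step 2: Cauchy in `L³((0,T) × T^d)` along `φ`
  have hcau : ∀ η : ℝ≥0∞, 0 < η → ∃ N : ℕ, ∀ n m : ℕ, N ≤ n → N ≤ m →
      ∫⁻ t in Ioo 0 T, ∫⁻ x, ‖u (φ n) t x - u (φ m) t x‖ₑ ^ 3 ≤ η := fun η hη =>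
    exists_forall_lintegral_sub_pow_three_le_of_modes hT hθ.1 (fun n => hsm (φ n)) hB
      (fun n => hwB (φ n)) hmodes hη
  -- Step 3: a fast further subsequence
  set r : ℝ≥0∞ := 2⁻¹ with hr
  have hr1 : r ≤ 1 := by rw [hr]; exact ENNReal.inv_le_one.2 one_le_two
  have hr0 : 0 < r := by rw [hr]; exact ENNReal.inv_pos.2 ENNReal.ofNat_ne_top
  set e : ℕ → ℝ≥0∞ := fun j => (r ^ (j + 1)) ^ 3 with he
  have he0 : ∀ j, 0 < e j := fun j => ENNReal.pow_pos (ENNReal.pow_pos hr0 _) 3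
  choose Nc hNc using fun j => hcau (e j) (he0 j)
  obtain ⟨ψ, hψ, hfast⟩ := exists_fast_subseq
    (a := fun n m => ∫⁻ t in Ioo 0 T, ∫⁻ x, ‖u (φ n) t x - u (φ m) t x‖ₑ ^ 3) hNc
  -- Step 4: completeness of `L³((0,T) × T^d)`
  set μT : Measure (ℝ × UnitAddTorus d) := (volume.restrict (Ioo 0 T)).prod volume with hμT
  set W : ℕ → ℝ × UnitAddTorus d → EuclideanSpace ℝ d := fun n => uncurry (u (φ (ψ n))) with hW
  have hWm : ∀ n, AEStronglyMeasurable (W n) μT := fun n => (hsm _).aestronglyMeasurable_uncurry_prod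
  have hcube : ∀ a : ℝ≥0∞, (a ^ (1 / 3 : ℝ)) ^ 3 = a := fun a => by
    rw [show (1 / 3 : ℝ) = ((3 : ℕ) : ℝ)⁻¹ by norm_num, ENNReal.rpow_inv_natCast_pow (by norm_num)]
  have hWmem : ∀ n, MemLp (W n) 3 μT := fun n => by
    refine ⟨hWm n, ?_⟩
    rw [hW, eLpNorm_uncurry_three_eq (hWm n)]
    exact ENNReal.rpow_lt_top_of_nonneg (by norm_num) (ne_top_of_le_ne_top hB (hL3 _))
  have hdiff : ∀ n m, eLpNorm (W n - W m) 3 μT =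
      (∫⁻ t in Ioo 0 T, ∫⁻ x, ‖u (φ (ψ n)) t x - u (φ (ψ m)) t x‖ₑ ^ 3) ^ (1 / 3 : ℝ) := by
    intro n m
    have h1 : W n - W m = uncurry (fun t x => u (φ (ψ n)) t x - u (φ (ψ m)) t x) := rfl
    rw [h1, eLpNorm_uncurry_three_eq ((hWm n).sub (hWm m))]
  have hsum : ∑' i, r ^ i ≠ ∞ := by
    rw [hr, ENNReal.tsum_geometric_two]
    exact ENNReal.ofNat_ne_top
  have h_cau : ∀ N n m : ℕ, N ≤ n → N ≤ m → eLpNorm (W n - W m) 3 μT < r ^ N := by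
    intro N n m hn hm
    set j : ℕ := min n m with hj
    have hjN : N ≤ j := le_min hn hm
    have h1 : ∫⁻ t in Ioo 0 T, ∫⁻ x, ‖u (φ (ψ n)) t x - u (φ (ψ m)) t x‖ₑ ^ 3 ≤ e j :=
      hfast j n m (min_le_left _ _) (min_le_right _ _)
    have h2 : eLpNorm (W n - W m) 3 μT ≤ r ^ (j + 1) := by
      rw [hdiff]
      calc (∫⁻ t in Ioo 0 T, ∫⁻ x, ‖u (φ (ψ n)) t x - u (φ (ψ m)) t x‖ₑ ^ 3) ^ (1 / 3 : ℝ)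
          ≤ (e j) ^ (1 / 3 : ℝ) := rpow_third_le_rpow_third h1
        _ = r ^ (j + 1) := pow_three_rpow_third _
    have h3 : r ^ (j + 1) ≤ r ^ (N + 1) := pow_le_pow_right_of_le_one' hr1 (Nat.succ_le_succ hjN)
    have h4 : r ^ (N + 1) < r ^ N := by
      rw [pow_succ, hr]
      exact ENNReal.half_lt_self (pow_ne_zero _ (ENNReal.inv_ne_zero.2 ENNReal.ofNat_ne_top))
        (ENNReal.pow_ne_top (ENNReal.inv_ne_top.2 two_ne_zero))
    exact h2.trans_lt (h3.trans_lt h4)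
  obtain ⟨V, hVmem, hVlim⟩ := Lp.cauchy_complete_eLpNorm (by norm_num : (1 : ℝ≥0∞) ≤ 3) hWmem hsum h_cau
  -- Step 5: unpack
  set v : ℝ → UnitAddTorus d → EuclideanSpace ℝ d := curry V with hv
  have hvV : uncurry v = V := uncurry_curry V
  have hvm : AEStronglyMeasurable (uncurry v) μT := by rw [hvV]; exact hVmem.1
  refine ⟨fun n => φ (ψ n), v, hφ.comp hψ, aestronglyMeasurable_stLift_of_uncurry hvm, ?_, ?_⟩
  · have h1 : eLpNorm (uncurry v) 3 μT = (∫⁻ t in Ioo 0 T, ∫⁻ x, ‖v t x‖ₑ ^ 3) ^ (1 / 3 : ℝ) :=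
      eLpNorm_uncurry_three_eq hvm
    calc ∫⁻ t in Ioo 0 T, ∫⁻ x, ‖v t x‖ₑ ^ (3 : ℕ)
        = ((∫⁻ t in Ioo 0 T, ∫⁻ x, ‖v t x‖ₑ ^ 3) ^ (1 / 3 : ℝ)) ^ 3 := (hcube _).symm
      _ = eLpNorm (uncurry v) 3 μT ^ 3 := by rw [h1]
      _ < ∞ := by
          rw [hvV]
          exact ENNReal.pow_lt_top hVmem.2
  · have h1 : ∀ k, ∫⁻ t in Ioo 0 T, ∫⁻ x, ‖u (φ (ψ k)) t x - v t x‖ₑ ^ (3 : ℕ) =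
        eLpNorm (W k - V) 3 μT ^ 3 := by
      intro k
      have h2 : W k - V = uncurry (fun t x => u (φ (ψ k)) t x - v t x) := by
        rw [← hvV]
        rfl
      rw [h2, eLpNorm_uncurry_three_eq ((hWm k).sub hvm), hcube]
    simp_rw [h1]
    have h3 := ((ENNReal.continuous_pow 3).tendsto 0).comp hVlim
    simpa [Function.comp_def] using h3

end Literature.Barriers.AnomalousDissipation

end
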